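import Mathlib
import HarnessLib
import Literature.Analysis.FluidPDE.ClassicalSolution
import Literature.Analysis.FluidPDE.ClassicalSolutionCalculus
import Literature.Analysis.FluidPDE.SpaceTimeCalculus
import Literature.Analysis.FluidPDE.FlatSwirlGauge
import Literature.Analysis.FluidPDE.KNSSThm52Integrand
import Literature.Analysis.FluidPDE.SelfSimilar

/-!
# Route `LocalPressureProfileDoor`, crux K2⁺ `MonotonePressureProfileRigidity` (stmt-NavierStokesRegularity-20180),
# line `birth`, stub `stub_smallSliceOfMonotonePressure` — helper 3/4: the FROZEN similarity-pressure slices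
# `q_τ(t,x) = (−τ) p(τ, √(τ/t) x)` in physical variables

Cell ns-regularity-ideate, seat ns-pressure-K2-p1 (LEAD; helper file, lands `--supports stmt-NavierStokesRegularity-20180`).

The K2⁺ hypothesis is the monotonicity in similarity time of the similarity pressure `P(τ, y) = (−τ) p(τ, √(−τ) y)` at every
similarity position `y`.  To use it WITHOUT any time-regularity of the pressure we pair the adapted kernel with the pressure slice
FROZEN at a physical time `τ < 0` and transported along similarity rays: `q_τ(t, x) = P(τ, x/√(−t)) = (−τ) p(τ, (√(−τ)/√(−t)) x)`.
For a classical solution `(v, p)` of Navier–Stokes (`ν = 1`, `f = 0`) on `(−∞, 0)` (in the application `p` is the Riesz pressure):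

* `isSmoothSpaceTimeOn_frozen` — `q_τ` is jointly smooth on `(−∞,0) × ℝ³`;
* `frozen_density_diag` — ON THE DIAGONAL `t = τ`: `∂ₜq_τ + v·∇q_τ − Δq_τ = ∇p(τ)·((−τ)v + ½x) − (−τ)Δp(τ)`
  (`∂ₜ` of the dilation factor `√(−τ)(−t)^{−1/2}` at `t = τ` is `1/(2(−τ))`);
* `frozen_window_bounds` — on a window `(a,b)`, `−1 ≤ a < b < 0`, `τ ∈ (a, b)`: uniform bounds on `q_τ, ∇q_τ, Δq_τ, ∂ₜq_τ` from the
  scale-invariant pressure bounds `(‖x‖+√(−t))^{2+k}‖Dᵏp‖ ≤ K`, `k ≤ 2`;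
* `frozen_antitone` — the K2⁺ shift hypothesis iterates to `P(τ', y) ≤ P(τ, y)` for `τ ≤ τ' < 0`, i.e. `q_{τ'}(t,·) ≤ q_τ(t,·)`
  pointwise at every common time `t`;
* `abs_neg_mul_pressure_le` — `|(−t) p(t,x)| ≤ K` (the `sup|P|` of the budget).

WHAT THIS IS NOT: not a claim about Navier–Stokes regularity; calculus for the budget of the L stub
(bears_on LADDER-NS N0, rung N0-LocalTubeDoorPressureProfile).
-/

noncomputable section

set_option linter.dupNamespace false -- the summit and its sub-problem share the name (CONVENTIONS §1)
set_option maxSynthPendingDepth 3 -- nested operator types `ℝ³ →L[ℝ] ℝ³ →L[ℝ] ℝ³`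

namespace Summit.NavierStokesRegularity.NavierStokesRegularity.Theorems.LocalPressureProfileDoorMonotonePressureProfileRigiditySmallSliceFrozen

open MeasureTheory Set Function Filter Metric Topology InnerProductSpace
open scoped ENNReal NNReal InnerProductSpace RealInnerProductSpace Laplacian ContDiff
open Literature.Analysis Literature.Analysis.FluidPDE

/-! ### The dilation factor `λ_τ(t) = √(−τ)/√(−t)` -/

/-- `λ_τ(τ) = 1`. [folklore] -/
theorem dil_self {τ : ℝ} (hτ : τ < 0) : Real.sqrt (-τ) / Real.sqrt (-τ) = 1 :=
  div_self (Real.sqrt_pos.2 (by linarith)).ne'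

/-- **`d/dt (√(−τ)/√(−t)) = √(−τ)/(2 (−t) √(−t))` for `t < 0`**, in particular `= 1/(2(−τ))` at `t = τ`. [folklore] -/
theorem hasDerivAt_dil {τ t : ℝ} (ht : t < 0) :
    HasDerivAt (fun s : ℝ => Real.sqrt (-τ) / Real.sqrt (-s))
      (Real.sqrt (-τ) / (2 * (-t) * Real.sqrt (-t))) t := by
  have hnt : 0 < -t := by linarith
  have hsq : HasDerivAt (fun s : ℝ => Real.sqrt (-s)) (-1 / (2 * Real.sqrt (-t))) t :=
    (hasDerivAt_neg t).sqrt (by linarith)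
  have hne : Real.sqrt (-t) ≠ 0 := (Real.sqrt_pos.2 hnt).ne'
  have hs2 : Real.sqrt (-t) ^ 2 = -t := Real.sq_sqrt hnt.le
  refine ((hasDerivAt_const t (Real.sqrt (-τ))).div hsq hne).congr_deriv ?_
  rw [hs2, zero_mul, zero_sub, div_eq_div_iff (by positivity) (by positivity)]
  field_simp

/-! ### Smoothness of the frozen field -/

/-- **Joint smoothness of the frozen slice** `q_τ(t,x) = (−τ) p(τ, (√(−τ)/√(−t)) x)` on `(−∞, 0) × ℝ³`, for a smooth slice
`p(τ, ·)`. [folklore] -/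
theorem isSmoothSpaceTimeOn_frozen {p : ℝ → EuclideanSpace ℝ (Fin 3) → ℝ} {τ : ℝ} (hp : ContDiff ℝ ∞ (p τ))
    {q : ℝ → EuclideanSpace ℝ (Fin 3) → ℝ}
    (hq : ∀ t x, q t x = (-τ) * p τ ((Real.sqrt (-τ) / Real.sqrt (-t)) • x)) :
    IsSmoothSpaceTimeOn (Iio 0) q := by
  have e : uncurry q = fun z : ℝ × EuclideanSpace ℝ (Fin 3) =>
      (-τ) * p τ ((Real.sqrt (-τ) / Real.sqrt (-z.1)) • z.2) := by
    funext z; rcases z with ⟨t, x⟩; exact hq t x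
  show ContDiffOn ℝ ∞ (uncurry q) (Iio (0 : ℝ) ×ˢ univ)
  rw [e]
  have hl : ContDiffOn ℝ ∞ (fun z : ℝ × EuclideanSpace ℝ (Fin 3) => Real.sqrt (-τ) / Real.sqrt (-z.1))
      (Iio (0 : ℝ) ×ˢ univ) := by
    refine contDiffOn_const.div ?_ fun z hz => (Real.sqrt_pos.2 (by exact neg_pos.2 (mem_prod.1 hz).1)).ne'
    exact (contDiffOn_fst.neg).sqrt fun z hz => by
      have : z.1 < 0 := (mem_prod.1 hz).1
      simp only [ne_eq, neg_eq_zero]; exact this.ne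
  exact contDiffOn_const.mul (hp.comp_contDiffOn (hl.smul contDiffOn_snd))

/-! ### The density on the diagonal -/

/-- **The frozen-slice density ON THE DIAGONAL.**  For a classical solution `(v, p)` (`ν = 1`, `f = 0`) on `(−∞,0)` and
`τ < 0`, the frozen field `q_τ(t,x) = (−τ) p(τ, (√(−τ)/√(−t))x)` satisfies at `t = τ`:
`∂ₜq_τ(τ,x) + Dq_τ(τ)(x)(v(τ,x)) − Δq_τ(τ)(x) = Dp(τ)(x)((−τ)v(τ,x) + ½x) − (−τ)Δp(τ)(x)`
(`∂ₜ` hits only the dilation factor, whose derivative at `t = τ` is `1/(2(−τ))`; in space the factor is `1` at `t = τ`).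
[cite: Tsai1998, (1.7)] -/
theorem frozen_density_diag {v : ℝ → EuclideanSpace ℝ (Fin 3) → EuclideanSpace ℝ (Fin 3)}
    {p : ℝ → EuclideanSpace ℝ (Fin 3) → ℝ} (hcl : IsClassicalNSSolutionOn (Iio 0) 1 0 v p) {τ : ℝ} (hτ : τ < 0)
    {q : ℝ → EuclideanSpace ℝ (Fin 3) → ℝ}
    (hq : ∀ t x, q t x = (-τ) * p τ ((Real.sqrt (-τ) / Real.sqrt (-t)) • x)) (x : EuclideanSpace ℝ (Fin 3)) :
    deriv (fun s => q s x) τ + fderiv ℝ (q τ) x (v τ x) - (Δ (q τ)) x =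
      fderiv ℝ (p τ) x ((-τ) • v τ x + (1 / 2 : ℝ) • x) - (-τ) * (Δ (p τ)) x := by
  have hp : ContDiff ℝ ∞ (p τ) := hcl.contDiff_pressure hτ
  have hp2 : ContDiff ℝ 2 (p τ) := hp.of_le (by norm_cast)
  have hpd : ∀ y, DifferentiableAt ℝ (p τ) y := fun y => (hp2.differentiable (by norm_num)) y
  have hnt : 0 < -τ := by linarith
  -- (1) time derivative at `t = τ`
  have h1 : deriv (fun s => q s x) τ = 1 / 2 * fderiv ℝ (p τ) x x := by
    have hcurve : HasDerivAt (fun s : ℝ => (Real.sqrt (-τ) / Real.sqrt (-s)) • x)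
        ((Real.sqrt (-τ) / (2 * (-τ) * Real.sqrt (-τ))) • x) τ := (hasDerivAt_dil hτ).smul_const x
    have hcomp : HasDerivAt (fun s : ℝ => p τ ((Real.sqrt (-τ) / Real.sqrt (-s)) • x))
        (fderiv ℝ (p τ) ((Real.sqrt (-τ) / Real.sqrt (-τ)) • x) ((Real.sqrt (-τ) / (2 * (-τ) * Real.sqrt (-τ))) • x)) τ :=
      (hpd _).hasFDerivAt.comp_hasDerivAt τ hcurve
    have e : (fun s => q s x) = fun s => (-τ) * p τ ((Real.sqrt (-τ) / Real.sqrt (-s)) • x) := funext fun s => hq s x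
    rw [e, (hcomp.const_mul (-τ)).deriv, dil_self hτ, one_smul, map_smul, smul_eq_mul]
    have hne : Real.sqrt (-τ) ≠ 0 := (Real.sqrt_pos.2 hnt).ne'
    have hτne : τ ≠ 0 := hτ.ne
    field_simp
  -- (2) space derivative at `t = τ`
  have e2 : q τ = fun y => (-τ) * p τ y := by
    funext y; rw [hq, dil_self hτ, one_smul]
  have h2 : fderiv ℝ (q τ) x (v τ x) = (-τ) * fderiv ℝ (p τ) x (v τ x) := by
    rw [e2, fderiv_const_mul (hpd x)]
    simp only [FunLike.coe_smul, Pi.smul_apply, smul_eq_mul]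
  -- (3) Laplacian at `t = τ`
  have h3 : (Δ (q τ)) x = (-τ) * (Δ (p τ)) x := by
    have e3 : q τ = (-τ) • p τ := by rw [e2]; funext y; simp only [Pi.smul_apply, smul_eq_mul]
    rw [e3, InnerProductSpace.laplacian_smul _ hp2.contDiffAt, smul_eq_mul]
  rw [h1, h2, h3, map_add, map_smul, map_smul, smul_eq_mul, smul_eq_mul]
  ring

/-! ### Bounds on a window -/

set_option maxHeartbeats 400000 in
/-- **Window bounds for the frozen slice.**  On a window `(a,b)`, `−1 ≤ a < b < 0`, for `τ ∈ (a,b)` and the frozen field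
`q_τ(t,x) = (−τ) p(τ, (√(−τ)/√(−t))x)`: if `(‖z‖+√(−τ))²|p(τ,z)| ≤ K`, `(‖z‖+√(−τ))³‖Dp(τ,z)‖ ≤ K`, `(‖z‖+√(−τ))⁴‖D²p(τ,z)‖ ≤ K`
for all `z`, then `q_τ, Dq_τ, Δq_τ, ∂ₜq_τ` are bounded on `(a,b) × ℝ³` by a constant depending on `K` and `b` only (uniformly in
`τ ∈ (a,b)`). [folklore] -/
theorem frozen_window_bounds {p : ℝ → EuclideanSpace ℝ (Fin 3) → ℝ} {τ a b K : ℝ} (ha : -1 ≤ a) (hb : b < 0)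
    (hτ : τ ∈ Ioo a b) (hp : ContDiff ℝ ∞ (p τ)) (hK : 0 ≤ K)
    (hp0 : ∀ z : EuclideanSpace ℝ (Fin 3), (‖z‖ + Real.sqrt (-τ)) ^ 2 * |p τ z| ≤ K)
    (hp1 : ∀ z : EuclideanSpace ℝ (Fin 3), (‖z‖ + Real.sqrt (-τ)) ^ 3 * ‖fderiv ℝ (p τ) z‖ ≤ K)
    (hp2 : ∀ z : EuclideanSpace ℝ (Fin 3), (‖z‖ + Real.sqrt (-τ)) ^ 4 * ‖iteratedFDeriv ℝ 2 (p τ) z‖ ≤ K)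
    {q : ℝ → EuclideanSpace ℝ (Fin 3) → ℝ}
    (hq : ∀ t x, q t x = (-τ) * p τ ((Real.sqrt (-τ) / Real.sqrt (-t)) • x)) :
    ∀ t ∈ Ioo a b, ∀ x : EuclideanSpace ℝ (Fin 3), |q t x| ≤ K / (-b) ∧ ‖fderiv ℝ (q t) x‖ ≤ K / (-b) ^ 2 ∧
      |(Δ (q t)) x| ≤ 3 * K / (-b) ^ 3 ∧ |timeDerivWithin (Ioo a b) q t x| ≤ K / (-b) ^ 2 := by
  intro t ht x
  have hτ0 : 0 < -τ := by linarith [hτ.2]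
  have ht0 : 0 < -t := by linarith [ht.2]
  have hb0 : 0 < -b := by linarith
  have hτ1 : -τ ≤ 1 := by linarith [hτ.1]
  have hbτ : -b ≤ -τ := by linarith [hτ.2]
  have hbt : -b ≤ -t := by linarith [ht.2]
  have hτne : τ ≠ 0 := by linarith
  have htne : t ≠ 0 := by linarith
  set sτ : ℝ := Real.sqrt (-τ) with hsτ
  set st : ℝ := Real.sqrt (-t) with hst
  have hsτ0 : 0 < sτ := Real.sqrt_pos.2 hτ0
  have hst0 : 0 < st := Real.sqrt_pos.2 ht0
  have hsτ2 : sτ ^ 2 = -τ := Real.sq_sqrt hτ0.le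
  have hst2 : st ^ 2 = -t := Real.sq_sqrt ht0.le
  set lam : ℝ := sτ / st with hlam
  have hlam0 : 0 < lam := div_pos hsτ0 hst0
  have hp2' : ContDiff ℝ 2 (p τ) := hp.of_le (by norm_cast)
  have hpd : ∀ y, DifferentiableAt ℝ (p τ) y := fun y => (hp2'.differentiable (by norm_num)) y
  set z : EuclideanSpace ℝ (Fin 3) := lam • x with hz
  have hρ : sτ ≤ ‖z‖ + sτ := by linarith [norm_nonneg z]
  have hρ0 : 0 < ‖z‖ + sτ := by positivity
  -- pointwise consequences of the weighted bounds at `z`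
  have b0 : |p τ z| ≤ K / (-τ) := by
    rw [le_div_iff₀ hτ0]
    calc |p τ z| * (-τ) = sτ ^ 2 * |p τ z| := by rw [hsτ2]; ring
      _ ≤ (‖z‖ + sτ) ^ 2 * |p τ z| :=
          mul_le_mul_of_nonneg_right (pow_le_pow_left₀ hsτ0.le hρ 2) (abs_nonneg _)
      _ ≤ K := hp0 z
  have b1 : ‖fderiv ℝ (p τ) z‖ ≤ K / (-τ * sτ) := by
    rw [le_div_iff₀ (by positivity)]
    calc ‖fderiv ℝ (p τ) z‖ * (-τ * sτ) = sτ ^ 3 * ‖fderiv ℝ (p τ) z‖ := by rw [← hsτ2]; ring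
      _ ≤ (‖z‖ + sτ) ^ 3 * ‖fderiv ℝ (p τ) z‖ :=
          mul_le_mul_of_nonneg_right (pow_le_pow_left₀ hsτ0.le hρ 3) (norm_nonneg _)
      _ ≤ K := hp1 z
  have b1z : ‖z‖ * ‖fderiv ℝ (p τ) z‖ ≤ K / (-τ) := by
    rw [le_div_iff₀ hτ0]
    calc ‖z‖ * ‖fderiv ℝ (p τ) z‖ * (-τ) = (‖z‖ * sτ ^ 2) * ‖fderiv ℝ (p τ) z‖ := by rw [hsτ2]; ring
      _ ≤ (‖z‖ + sτ) ^ 3 * ‖fderiv ℝ (p τ) z‖ := by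
          refine mul_le_mul_of_nonneg_right ?_ (norm_nonneg _)
          nlinarith [norm_nonneg z, mul_nonneg (norm_nonneg z) hsτ0.le, sq_nonneg ‖z‖]
      _ ≤ K := hp1 z
  have b2 : ‖iteratedFDeriv ℝ 2 (p τ) z‖ ≤ K / (-τ) ^ 2 := by
    rw [le_div_iff₀ (by positivity)]
    calc ‖iteratedFDeriv ℝ 2 (p τ) z‖ * (-τ) ^ 2 = sτ ^ 4 * ‖iteratedFDeriv ℝ 2 (p τ) z‖ := by rw [← hsτ2]; ring
      _ ≤ (‖z‖ + sτ) ^ 4 * ‖iteratedFDeriv ℝ 2 (p τ) z‖ :=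
          mul_le_mul_of_nonneg_right (pow_le_pow_left₀ hsτ0.le hρ 4) (norm_nonneg _)
      _ ≤ K := hp2 z
  -- the slice `q t = (−τ) p(τ, λ ·)` and its derivatives
  have et : q t = fun y => (-τ) * p τ (lam • y) := funext fun y => hq t y
  have hinner : DifferentiableAt ℝ (fun y : EuclideanSpace ℝ (Fin 3) => p τ (lam • y)) x :=
    (hpd _).comp x (differentiableAt_id.const_smul lam)
  have hD : fderiv ℝ (q t) x = ((-τ) * lam) • fderiv ℝ (p τ) z := by
    rw [et, fderiv_const_mul hinner, _root_.fderiv_comp_smul, smul_smul]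
  have hΔ : (Δ (q t)) x = (-τ) * lam ^ 2 * (Δ (p τ)) z := by
    have e3 : q t = (-τ) • fun y => p τ (lam • y) := by rw [et]; funext y; simp only [Pi.smul_apply, smul_eq_mul]
    have hc : ContDiffAt ℝ 2 (fun y : EuclideanSpace ℝ (Fin 3) => p τ (lam • y)) x :=
      (hp2'.comp (contDiff_const_smul lam)).contDiffAt
    rw [e3, InnerProductSpace.laplacian_smul _ hc, laplacian_comp_smul_eq (p τ) lam x, smul_eq_mul, smul_eq_mul]
    ring
  -- sizes of the factors: `(−τ)λ ≤ (−τ)·√(−τ)/√(−b)`, etc.; we only need crude bounds by powers of `1/(−b)`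
  have hlam_le : lam ≤ sτ / Real.sqrt (-b) :=
    div_le_div_of_nonneg_left hsτ0.le (Real.sqrt_pos.2 hb0) (Real.sqrt_le_sqrt hbt)
  have hsb2 : Real.sqrt (-b) ^ 2 = -b := Real.sq_sqrt hb0.le
  have hsb0 : 0 < Real.sqrt (-b) := Real.sqrt_pos.2 hb0
  refine ⟨?_, ?_, ?_, ?_⟩
  · -- `|q|`
    rw [hq t x, abs_mul, abs_of_pos hτ0]
    calc (-τ) * |p τ z| ≤ (-τ) * (K / (-τ)) := mul_le_mul_of_nonneg_left b0 hτ0.le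
      _ = K := by field_simp
      _ ≤ K / (-b) := by rw [le_div_iff₀ hb0]; nlinarith
  · -- `‖Dq‖`
    rw [hD, norm_smul, Real.norm_of_nonneg (by positivity)]
    calc (-τ) * lam * ‖fderiv ℝ (p τ) z‖ ≤ (-τ) * lam * (K / (-τ * sτ)) :=
          mul_le_mul_of_nonneg_left b1 (by positivity)
      _ = K / st := by rw [hlam]; field_simp
      _ ≤ K / Real.sqrt (-b) := div_le_div_of_nonneg_left hK hsb0 (Real.sqrt_le_sqrt hbt)
      _ ≤ K / (-b) ^ 2 := by
          refine div_le_div_of_nonneg_left hK (by positivity) ?_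
          nlinarith [Real.sqrt_le_sqrt (show -b ≤ 1 by linarith), Real.sqrt_one]
  · -- `|Δq|`
    rw [hΔ, abs_mul, abs_of_pos (by positivity)]
    have hΔp : |(Δ (p τ)) z| ≤ 3 * (K / (-τ) ^ 2) := by
      have h := norm_laplacian_le_three_mul (p τ) z
      rw [Real.norm_eq_abs] at h
      exact h.trans (by linarith [b2])
    calc (-τ) * lam ^ 2 * |(Δ (p τ)) z| ≤ (-τ) * lam ^ 2 * (3 * (K / (-τ) ^ 2)) :=
          mul_le_mul_of_nonneg_left hΔp (by positivity)
      _ = 3 * K / (-t) := by rw [hlam, div_pow, hsτ2, hst2]; field_simp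
      _ ≤ 3 * K / (-b) := div_le_div_of_nonneg_left (by positivity) hb0 hbt
      _ ≤ 3 * K / (-b) ^ 3 := by
          refine div_le_div_of_nonneg_left (by positivity) (by positivity) ?_
          nlinarith [show (-b) ^ 2 ≤ 1 by nlinarith]
  · -- `|∂ₜq|`: `∂ₜq_τ(t,x) = (−τ) Dp(τ,z)((sτ/(2(−t)st)) x)` and `x = λ⁻¹ z`
    have hcomp : HasDerivAt (fun s : ℝ => p τ ((Real.sqrt (-τ) / Real.sqrt (-s)) • x))
        (fderiv ℝ (p τ) z ((sτ / (2 * (-t) * st)) • x)) t :=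
      (hpd _).hasFDerivAt.comp_hasDerivAt t ((hasDerivAt_dil (show t < 0 by linarith)).smul_const x)
    have e : (fun s => q s x) = fun s => (-τ) * p τ ((Real.sqrt (-τ) / Real.sqrt (-s)) • x) :=
      funext fun s => hq s x
    rw [timeDerivWithin_eq_deriv isOpen_Ioo ht, e, (hcomp.const_mul (-τ)).deriv, map_smul, smul_eq_mul]
    have hxz : x = lam⁻¹ • z := by rw [hz, smul_smul, inv_mul_cancel₀ hlam0.ne', one_smul]
    have hDz : |fderiv ℝ (p τ) z x| ≤ lam⁻¹ * (K / (-τ)) := by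
      rw [hxz, map_smul, smul_eq_mul, abs_mul, abs_of_pos (inv_pos.2 hlam0)]
      refine mul_le_mul_of_nonneg_left ?_ (inv_pos.2 hlam0).le
      rw [← Real.norm_eq_abs]
      exact ((fderiv ℝ (p τ) z).le_opNorm z).trans (by rw [mul_comm]; exact b1z)
    rw [abs_mul, abs_mul, abs_of_pos hτ0, abs_of_pos (by positivity)]
    calc (-τ) * (sτ / (2 * (-t) * st) * |fderiv ℝ (p τ) z x|)
        ≤ (-τ) * (sτ / (2 * (-t) * st) * (lam⁻¹ * (K / (-τ)))) := by gcongr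
      _ = K / (2 * (-t)) := by rw [hlam]; field_simp
      _ ≤ K / (-b) := div_le_div_of_nonneg_left hK hb0 (by linarith)
      _ ≤ K / (-b) ^ 2 := div_le_div_of_nonneg_left hK (by positivity) (by nlinarith)

/-! ### Monotonicity: the K2⁺ shift hypothesis iterated -/

/-- **Iterating the shift hypothesis.**  If `P(e^{−σ}t, y) ≤ P(t, y)` for all `t < 0`, `σ ∈ [0,1]`, `y`
(`P(t,y) = (−t) p(t, √(−t) y)`, the K2⁺ hypothesis), then `P(τ', y) ≤ P(τ, y)` whenever `τ ≤ τ' < 0`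
(write `τ' = e^{−σ}τ` with `σ = log(τ/τ') ≥ 0` and split `σ` into `n` steps of length `≤ 1`). [folklore] -/
theorem frozen_antitone {p : ℝ → EuclideanSpace ℝ (Fin 3) → ℝ}
    (hmono : ∀ t < (0 : ℝ), ∀ σ ∈ Icc (0 : ℝ) 1, ∀ y : EuclideanSpace ℝ (Fin 3),
      (-(Real.exp (-σ) * t)) * p (Real.exp (-σ) * t) (Real.sqrt (-(Real.exp (-σ) * t)) • y) ≤
        (-t) * p t (Real.sqrt (-t) • y))
    {τ τ' : ℝ} (hττ' : τ ≤ τ') (hτ' : τ' < 0) (y : EuclideanSpace ℝ (Fin 3)) :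
    (-τ') * p τ' (Real.sqrt (-τ') • y) ≤ (-τ) * p τ (Real.sqrt (-τ) • y) := by
  have hτ : τ < 0 := lt_of_le_of_lt hττ' hτ'
  -- `n` steps of size `σ/n ≤ 1`, `σ = log(τ/τ')`
  set σ : ℝ := Real.log (τ / τ') with hσ
  have hσ0 : 0 ≤ σ := Real.log_nonneg (by rw [le_div_iff_of_neg hτ']; linarith)
  obtain ⟨n, hn⟩ := exists_nat_ge σ
  have hstep : ∀ (k : ℕ) (s : ℝ), 0 ≤ s → s ≤ 1 → ∀ t < (0 : ℝ),
      (-(Real.exp (-(k * s)) * t)) * p (Real.exp (-(k * s)) * t) (Real.sqrt (-(Real.exp (-(k * s)) * t)) • y) ≤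
        (-t) * p t (Real.sqrt (-t) • y) := by
    intro k s hs0 hs1
    induction k with
    | zero => intro t ht; simp
    | succ k ih =>
        intro t ht
        have ht' : Real.exp (-(k * s)) * t < 0 := mul_neg_of_pos_of_neg (Real.exp_pos _) ht
        have h1 := hmono _ ht' s ⟨hs0, hs1⟩ y
        have e : Real.exp (-s) * (Real.exp (-(k * s)) * t) = Real.exp (-((k + 1 : ℕ) * s)) * t := by
          rw [← mul_assoc, ← Real.exp_add]; congr 1; push_cast; ring
        rw [e] at h1
        exact h1.trans (ih t ht)
  rcases Nat.eq_zero_or_pos n with hn0 | hnpos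
  · -- `σ ≤ 0`, so `σ = 0` and `τ = τ'`
    have hσz : σ = 0 := le_antisymm (by rw [hn0] at hn; exact_mod_cast hn) hσ0
    have hττ : τ = τ' := by
      have h1 : τ / τ' = 1 := by
        refine Real.eq_one_of_pos_of_log_eq_zero (div_pos_of_neg_of_neg hτ hτ') ?_
        rw [← hσ]; exact hσz
      exact (div_eq_one_iff_eq hτ'.ne).1 h1
    rw [hττ]
  · have hs0 : 0 ≤ σ / n := div_nonneg hσ0 (Nat.cast_nonneg n)
    have hs1 : σ / n ≤ 1 := by rw [div_le_one (by exact_mod_cast hnpos)]; exact hn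
    have h := hstep n (σ / n) hs0 hs1 τ hτ
    have e : Real.exp (-(n * (σ / n))) * τ = τ' := by
      rw [mul_div_cancel₀ _ (by exact_mod_cast hnpos.ne'), hσ, Real.exp_neg,
        Real.exp_log (div_pos_of_neg_of_neg hτ hτ'), inv_div, div_mul_cancel₀ τ' hτ.ne]
    rwa [e] at h

/-- **Pointwise order of the frozen fields at a common time.**  Under the K2⁺ shift hypothesis, for `τ ≤ τ' < 0`, `t < 0`
and the frozen fields `q_τ(t,x) = (−τ)p(τ,(√(−τ)/√(−t))x)`, `q_{τ'}` likewise: `q_{τ'}(t, x) ≤ q_τ(t, x)` for all `x`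
(`(√(−τ)/√(−t)) x = √(−τ) • (x/√(−t))`). [folklore] -/
theorem frozen_le_frozen {p : ℝ → EuclideanSpace ℝ (Fin 3) → ℝ}
    (hmono : ∀ t < (0 : ℝ), ∀ σ ∈ Icc (0 : ℝ) 1, ∀ y : EuclideanSpace ℝ (Fin 3),
      (-(Real.exp (-σ) * t)) * p (Real.exp (-σ) * t) (Real.sqrt (-(Real.exp (-σ) * t)) • y) ≤
        (-t) * p t (Real.sqrt (-t) • y))
    {τ τ' t : ℝ} (hττ' : τ ≤ τ') (hτ' : τ' < 0) (x : EuclideanSpace ℝ (Fin 3)) :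
    (-τ') * p τ' ((Real.sqrt (-τ') / Real.sqrt (-t)) • x) ≤ (-τ) * p τ ((Real.sqrt (-τ) / Real.sqrt (-t)) • x) := by
  have e : ∀ c : ℝ, (c / Real.sqrt (-t)) • x = c • ((Real.sqrt (-t))⁻¹ • x) := fun c => by
    rw [smul_smul, div_eq_mul_inv]
  rw [e, e]
  exact frozen_antitone hmono hττ' hτ' _

/-! ### The size of the similarity pressure -/

/-- **`|(−t) p(t,x)| ≤ K`** from the scale-invariant bound `(‖x‖+√(−t))²|p(t,x)| ≤ K` (`(√(−t))² ≤ (‖x‖+√(−t))²`). [folklore] -/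
theorem abs_neg_mul_pressure_le {p : ℝ → EuclideanSpace ℝ (Fin 3) → ℝ} {K t : ℝ} (ht : t < 0)
    (hp0 : ∀ z : EuclideanSpace ℝ (Fin 3), (‖z‖ + Real.sqrt (-t)) ^ 2 * |p t z| ≤ K) (x : EuclideanSpace ℝ (Fin 3)) :
    |(-t) * p t x| ≤ K := by
  have ht0 : 0 < -t := by linarith
  have hs : Real.sqrt (-t) ^ 2 = -t := Real.sq_sqrt ht0.le
  have hρ : Real.sqrt (-t) ≤ ‖x‖ + Real.sqrt (-t) := by linarith [norm_nonneg x]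
  rw [abs_mul, abs_of_pos ht0]
  calc (-t) * |p t x| = Real.sqrt (-t) ^ 2 * |p t x| := by rw [hs]
    _ ≤ (‖x‖ + Real.sqrt (-t)) ^ 2 * |p t x| :=
        mul_le_mul_of_nonneg_right (pow_le_pow_left₀ (Real.sqrt_nonneg _) hρ 2) (abs_nonneg _)
    _ ≤ K := hp0 x

end Summit.NavierStokesRegularity.NavierStokesRegularity.Theorems.LocalPressureProfileDoorMonotonePressureProfileRigiditySmallSliceFrozen

end
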